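import Summits.PneNP.PneNP.Theorems.SymmetryBudgetWindowBarrierCoreReduction
import Summits.PneNP.PneNP.Theorems.SymmetryBudgetWindowBarrierCoreBridge
import Summits.PneNP.PneNP.Theorems.SymmetryBudgetNoHiddenOrderIffNotWindowBarrier

/-!
# A hard invariant FUNCTION of the window proves `WindowBarrier` — pairs are not needed
(dichotomy `WindowBarrier` stmt-PneNP-2145 / `NoHiddenOrder` stmt-PneNP-14781, route `PneNP/SymmetryBudget`)

Every witness programme for the crux so far asks for indistinguishable PAIRS: (★) CoreFooling
(`stub_coreReduction`), TwinIsoHard, HardToIdentify, and — exactly equivalent to them — entropy games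
on non-isomorphic pairs (`hardToIdentify_iff_entropyGames`, `coreFooling_iff_hardToIdentify`).
This file records the more general sufficient condition, in which pairs do not appear:

**`windowBarrier_of_hardWindowFunction`.**  Let `f g : SimpleGraph (Fin g) → Bool` be ANY
isomorphism-invariant graph function such that the planted language
"`⟨m, G⟩ ↦ f ⌊log₂ m⌋ (G restricted to the last ⌊log₂ m⌋ vertices)`" is in `P` (i.e. `f` is
computable in time `2^{O(g)}` on `g`-vertex graphs, uniformly).  If for every rate `c`, for
infinitely many `g`, NO `Sym(Fin g)`-symmetric threshold circuit with at most `2^{cg}` gates agrees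
with `f g` on all adjacency matrices, then `WindowBarrier` holds (and `NoHiddenOrder` fails).

Proof: otherwise `NoHiddenOrder` (`noHiddenOrder_iff_not_windowBarrier`) applied to the planted
language — whose slices are `Bud`-invariant because a budget permutation restricts to the window
(`CoreBridge.exists_restrict`) and `f` is invariant — gives `Bud(m,⌊log₂ m⌋)`-symmetric circuits of
size `p(m)` for all large `m`; at `m = 2^g` the hard-wiring transfer `CoreReduction.exists_core_circuit`
turns such a circuit into a `Sym(Fin g)`-symmetric circuit with `p(2^g) + 2 ≤ 2^{dg}` gates agreeing
with `f g` on every graph (`CoreReduction.exists_plant`, `exists_pow_bound`), contradicting hardness at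
rate `d`.

Why this matters for the dichotomy.  By the soundness/completeness of the entropy game
(`…EntropyGameSize.lean`), for large `K` two graphs are separated by some symmetric circuit of size
`2^{c(K)g}` unless they admit an entropy-`K` game; so if HardToIdentify FAILS, every two
non-isomorphic graphs are separated in the window — and yet an invariant `f` may still have no
symmetric circuit of size `2^{O(g)}`: symmetric circuits of that size compute at most `2^{2^{O(g)}}` of
the `2^{2^{Θ(g²)}}` invariant functions on `g`-vertex graphs, so almost every invariant function is
hard WITHOUT any indistinguishable pair ("aggregation hardness").  An explicit such `f` in time
`2^{O(g)}` proves the crux by this theorem, in the regime where the game method is void.  HardToIdentify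
is the instance `f g = [· ≅ H_g]` (up to the input convention), TwinIsoHard the instance where the
pattern is read off the matrix.  No definitions, no sorry, no new Literature facts.
-/

set_option linter.dupNamespace false -- `Summit.PneNP.PneNP.…`: summit = sub-problem name (D-0017 single-conjunct layout)

namespace Summit.PneNP.PneNP.Theorems

open Literature.Computability.Complexity Filter CoreReduction CoreBridge
open Summit.PneNP.PneNP.Theses.SymmetryBudget
open scoped Classical

namespace HardWindowFunction

/-- **The window slice of an invariant function is `Bud`-invariant**: relabelling the input matrix
by a budget permutation relabels the window graph (the graph of the matrix restricted to the last `g`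
vertices) by the restriction of that permutation. -/
theorem window_invariant (f : (g : ℕ) → SimpleGraph (Fin g) → Bool)
    (hinv : ∀ (g : ℕ) (G H : SimpleGraph (Fin g)), Nonempty (G ≃g H) → f g G = f g H)
    (n g : ℕ) (ρ : Equiv.Perm (Fin (n + g))) (hρ : ρ ∈ pointStabiliserBudget (n + g) g)
    (x : Fin (n + g) × Fin (n + g) → Bool) :
    f g ((SimpleGraph.fromRel fun u v => x (ρ u, ρ v) = true).comap
        fun j : Fin g => (⟨n + j, free_lt n j⟩ : Fin (n + g))) =
      f g ((SimpleGraph.fromRel fun u v => x (u, v) = true).comap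
        fun j : Fin g => (⟨n + j, free_lt n j⟩ : Fin (n + g))) := by
  obtain ⟨σ, hσ⟩ := exists_restrict ρ hρ
  refine hinv g _ _ ⟨⟨σ, ?_⟩⟩
  intro i j
  have hinj : ∀ {a b : Fin g}, ((⟨n + a, free_lt n a⟩ : Fin (n + g)) = ⟨n + b, free_lt n b⟩) ↔ a = b := by
    intro a b
    constructor
    · intro h
      simp only [Fin.mk.injEq] at h
      exact Fin.ext (by omega)
    · rintro rfl; rfl
  simp only [SimpleGraph.comap_adj, SimpleGraph.fromRel_adj, hσ, ne_eq, hinj, σ.injective.eq_iff]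

end HardWindowFunction

open HardWindowFunction

/-- **A hard invariant function of the window proves `WindowBarrier`.**  If an isomorphism-invariant
graph function `f`, whose planted window language is in `P`, has for every rate `c` infinitely often
no `Sym(Fin g)`-symmetric `tcBasis`-circuit with `≤ 2^{cg}` gates agreeing with it on all adjacency
matrices of `g`-vertex graphs, then `WindowBarrier` (crux stmt-PneNP-2145) holds.  Pairs of
indistinguishable graphs are NOT required: (★)/HardToIdentify/entropy games are the special case
`f g = [· ≅ H_g]`. -/
theorem windowBarrier_of_hardWindowFunction : ∀ (f : (g : ℕ) → SimpleGraph (Fin g) → Bool), (∀ (g : ℕ) (G H : SimpleGraph (Fin g)), Nonempty (G ≃g H) → f g G = f g H) → (∃ L ∈ Literature.Computability.Complexity.Classes.P, ∀ (n g : ℕ), Nat.log 2 (n + g) = g → ∀ G : SimpleGraph (Fin (n + g)), Literature.Computability.Complexity.encodingGraph.encode ⟨n + g, G⟩ ∈ L ↔ f g (G.comap fun j : Fin g => (⟨n + j, Summit.PneNP.PneNP.Theorems.CoreBridge.free_lt n j⟩ : Fin (n + g))) = true) → (∀ c : ℕ, ∃ᶠ g in Filter.atTop, ¬ ∃ D :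 Literature.Computability.Complexity.Circuit (Fin g × Fin g), D.IsOver Literature.Computability.Complexity.tcBasis ∧ D.size ≤ 2 ^ (c * g) ∧ D.IsSymmetricUnder Set.univ ∧ ∀ G : SimpleGraph (Fin g), D.eval (fun p : Fin g × Fin g => @decide (G.Adj p.1 p.2) (Classical.propDecidable _)) = f g G) → Summit.PneNP.PneNP.Theses.SymmetryBudget.WindowBarrier := by
  intro f hinv hP hhard
  by_contra hWB
  have hN : NoHiddenOrder := noHiddenOrder_iff_not_windowBarrier.2 hWB
  obtain ⟨L, hL, hLf⟩ := hP
  -- the slices of the planted language are `Bud`-invariant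
  have hinvL : ∀ (m : ℕ), ∀ ρ ∈ pointStabiliserBudget m (Nat.log 2 m), ∀ x : Fin m × Fin m → Bool,
      (encodingGraph.encode ⟨m, SimpleGraph.fromRel fun u v =>
          (fun q : Fin m × Fin m => x (ρ q.1, ρ q.2)) (u, v) = true⟩ ∈ L ↔
        encodingGraph.encode ⟨m, SimpleGraph.fromRel fun u v => x (u, v) = true⟩ ∈ L) := by
    intro m
    have hlm : Nat.log 2 m ≤ m := by
      rcases Nat.eq_zero_or_pos m with rfl | hm
      · simp
      · exact (Nat.lt_two_pow_self).le.trans (Nat.pow_log_le_self 2 hm.ne')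
    obtain ⟨n, g, rfl, hlog⟩ : ∃ n g : ℕ, m = n + g ∧ Nat.log 2 m = g :=
      ⟨m - Nat.log 2 m, Nat.log 2 m, (Nat.sub_add_cancel hlm).symm, rfl⟩
    intro ρ hρ x
    rw [hlog] at hρ
    rw [hLf n g hlog, hLf n g hlog, window_invariant f hinv n g ρ hρ x]
  obtain ⟨p, hp⟩ := hN L hL hinvL
  obtain ⟨M, hM⟩ := Filter.eventually_atTop.1 hp
  obtain ⟨d, g₀, hd⟩ := exists_pow_bound p
  obtain ⟨g, hg, hng⟩ := (Filter.frequently_atTop.1 (hhard d)) (max g₀ M)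
  have hg₀ : g₀ ≤ g := le_of_max_le_left hg
  have hgM : M ≤ g := le_of_max_le_right hg
  -- `m = 2^g = n + g`
  have hgle : g ≤ 2 ^ g := (Nat.lt_two_pow_self).le
  set n : ℕ := 2 ^ g - g with hn
  have hm : n + g = 2 ^ g := by omega
  have hlog : Nat.log 2 (n + g) = g := by rw [hm, Nat.log_pow (by norm_num)]
  obtain ⟨C, hCB, hCs, hCsym, hCcomp⟩ := hM (n + g) (by omega)
  have hCsym' : C.IsSymmetricUnder (pointStabiliserBudget (n + g) (Nat.log 2 (n + g))) := hCsym
  rw [hlog] at hCsym'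
  obtain ⟨D, hDB, hDs, hDsym, hDev⟩ := exists_core_circuit n g C hCB hCsym'
  refine hng ⟨D, hDB, ?_, hDsym, fun G₀ => ?_⟩
  · rw [hDs]
    have h1 := hd g hg₀
    rw [← hm] at h1
    have h2 : C.size ≤ p.eval (n + g) := hCs
    omega
  · obtain ⟨x₀, hx₀f, hx₀0, hx₀1⟩ := exists_plant n G₀
    have hwin : (SimpleGraph.fromRel fun u v => x₀ (u, v) = true).comap
        (fun j : Fin g => (⟨n + j, free_lt n j⟩ : Fin (n + g))) = G₀ := by
      ext i j
      simp only [SimpleGraph.comap_adj, SimpleGraph.fromRel_adj, ne_eq]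
      rw [show (⟨n + i, free_lt n i⟩ : Fin (n + g)) = ⟨n + i, freeIdx_lt n i⟩ from rfl,
        show (⟨n + j, free_lt n j⟩ : Fin (n + g)) = ⟨n + j, freeIdx_lt n j⟩ from rfl,
        hx₀f i j, hx₀f j i, freeIdx_inj]
      simp only [decide_eq_true_eq]
      constructor
      · rintro ⟨-, h | h⟩
        · exact h
        · exact h.symm
      · intro h
        exact ⟨G₀.ne_of_adj h, Or.inl h⟩
    have key : encodingGraph.encode ⟨n + g, SimpleGraph.fromRel fun u v => x₀ (u, v) = true⟩ ∈ L ↔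
        f g G₀ = true := by
      rw [hLf n g hlog, hwin]
    have hev : C.eval x₀ = decide (encodingGraph.encode
        ⟨n + g, SimpleGraph.fromRel fun u v => x₀ (u, v) = true⟩ ∈ L) := hCcomp x₀
    rw [hDev G₀ x₀ hx₀0 hx₀1, hev]
    cases hf : f g G₀
    · simpa [hf] using key
    · simpa [hf] using key

end Summit.PneNP.PneNP.Theorems
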